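import Mathlib
import Literature.Analysis.PDE.Wave1DNearWindowedChannel
import HarnessLib

/-!
# The windowed channel inequality on the growing side of a potential: the SHARP constant

Analysis/PDE support file (everything proved, no definitions). Sequel to
`Wave1DNearWindowedChannel.lean`: for `C²` solutions of `ψ_tt − ψ_xx + V(x)ψ = 0` with `V ∈ C¹`,
`V ≥ 0` and `V′ ≥ 2κV` on `(−∞, x_w]` (`κ ≥ 0`), and Cauchy data supported in `(−∞, x_e]`,
`x_e = x_w − h`, the two-ended windowed channel inequality holds with the constant

  `c(κh) = (1 − 2e^{−κh}) / (1 − e^{−κh}) = (λ − 2)/(λ − 1)`,  `λ = e^{κh}`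

(`wave1D_nearWindowedChannel_sharp`), positive as soon as `κh > log 2`. In the exact Rindler model
`V = m²e^{2κx}` (`V′ = 2κV`) this is the statement that a Klein–Gordon datum of any mass supported
below `x_e` on the Rindler wedge sends at least the fraction `(λ−2)/(λ−1)` of its energy through the
horizons BEFORE the advanced/retarded times `x_e + h`, for every lag `h > κ⁻¹ log 2` — the threshold
`4M log 2` of the design note of `WindowedShellChannels` (route PhotonSphereChannels,
stmt-FinalStateConjecture-14085; there `κ = 1/4M`), below which rest packets are lost in both
directions (`Theorems.not_UniformPhotonSphereChannels`). The constant is the value of the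
null-multiplier linear programme of `Cruxes/WindowedShellChannels/Ideas/null-multiplier-lp.md`.

Method: the optimal weight `β(v) = α₀(1 − e^{−κ(v − x_e)})₊`, `α₀ = λ/(λ−1)`, has a kink on the null
line `v = x_e`; it is realised by THREE smooth-weight trapezoid identities
(`wave1D_nullMultiplier_trapezoid_identity`): the smooth continuation
`β₂(v) = α₀(1 − e^{−κ(v − x_e)})` on the trapezoids over `[b, x_w]` and over `[b, x_e]` (their
difference is the identity on the strip `{x_e − τ ≤ x ≤ x_w − τ}`, where `β₂ ≥ 0` and the bulk
`(α₀ − β₂)(2κV − V′)ψ² ≤ 0`), and the weight `β ≡ 0` on the trapezoid over `[b, x_e]` (bulk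
`−α₀V′ψ² ≤ 0`); the two fluxes through the internal line `x = x_e − τ` agree because `β₂(x_e) = 0`, and
the unsigned left fluxes cancel identically (`wave1D_roofFlux_le_sharp`).

References: multiplier method folklore (S. Alinhac, *Hyperbolic Partial Differential Equations*,
2009, Ch. 6); statement and constant recorded here with their proof.
-/

noncomputable section

namespace Literature.Analysis.PDE

open MeasureTheory Set Filter Topology intervalIntegral Literature.Analysis.Calculus

section Sharp

variable {V : ℝ → ℝ} {ψ : ℝ → ℝ → ℝ}

/-- Continuity of a bulk slice integral with both ends moving: for jointly continuous `S`,
`τ ↦ ∫_{c+τ}^{d−τ} S(τ, x) dx` is continuous. [folklore] -/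
theorem continuous_trapezoidSlice_integral {S : ℝ → ℝ → ℝ} (hS : Continuous (Function.uncurry S))
    (c d : ℝ) : Continuous fun τ => ∫ x in (c + τ)..(d - τ), S τ x := by
  have hcont2 : ∀ {u v : ℝ → ℝ}, Continuous u → Continuous v → Continuous fun y => S (u y) (v y) :=
    fun hu hv => hS.comp (hu.prodMk hv)
  have h1 : Continuous fun τ => ∫ x in (0 : ℝ)..(d - τ), S τ x :=
    intervalIntegral.continuous_parametric_intervalIntegral_of_continuous hS
      (continuous_const.sub continuous_id)
  have h2 : Continuous fun τ => ∫ x in (0 : ℝ)..(c + τ), S τ x :=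
    intervalIntegral.continuous_parametric_intervalIntegral_of_continuous hS
      (continuous_const.add continuous_id)
  have heq : (fun τ => ∫ x in (c + τ)..(d - τ), S τ x)
      = fun τ => (∫ x in (0 : ℝ)..(d - τ), S τ x) - ∫ x in (0 : ℝ)..(c + τ), S τ x := by
    funext τ
    rw [integral_interval_sub_left]
    · exact (hcont2 continuous_const continuous_id).intervalIntegrable _ _
    · exact (hcont2 continuous_const continuous_id).intervalIntegrable _ _
  rw [heq]
  exact h1.sub h2

/-- **Sharp roof-flux bound.** Let `V ∈ C¹`, `V ≥ 0`, `κ ≥ 0` and `V′ ≥ 2κV` on `(−∞, x_w]`; let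
`x_e ≤ x_w`, `α₀ ≥ 0` with `α₀(1 − e^{−κ(x_w − x_e)}) ≥ 1`, and let `ψ` be a `C²` solution of
`ψ_tt − ψ_xx + Vψ = 0` whose Cauchy data vanish on `[x_e, ∞)`. Then for `t ≥ 0` and `b + t ≤ x_e − t`
`∫_{x_w−t}^{x_w} [(ψ_t − ψ_x)² + Vψ²](x_w − x, x) dx ≤ (α₀/2) ∫_b^{x_e} [(ψ_t − ψ_x)² + Vψ²](0, x) dx`
— the kinked optimal null-multiplier weight realised by three smooth-weight trapezoid identities
(see the module docstring). [folklore] -/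
theorem wave1D_roofFlux_le_sharp (hV : ContDiff ℝ 1 V) (hV0 : ∀ x, 0 ≤ V x) {κ xe xw : ℝ}
    (hκ : 0 ≤ κ) (hmono : ∀ x, x ≤ xw → 2 * κ * V x ≤ deriv V x) (hew : xe ≤ xw) {α₀ : ℝ}
    (hα0 : 0 ≤ α₀) (hαw : 1 ≤ α₀ * (1 - Real.exp (-(κ * (xw - xe)))))
    (hψ : ContDiff ℝ 2 (Function.uncurry ψ))
    (hsol : ∀ t x, iteratedDeriv 2 (fun τ => ψ τ x) t - iteratedDeriv 2 (ψ t) x + V x * ψ t x = 0)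
    (hsupp : ∀ x, xe ≤ x → ψ 0 x = 0 ∧ deriv (fun τ => ψ τ x) 0 = 0)
    {b t : ℝ} (ht : 0 ≤ t) (hb : b + t ≤ xe - t) :
    ∫ x in (xw - t)..xw, ((deriv (fun τ => ψ τ x) (xw - x) - deriv (ψ (xw - x)) x) ^ 2
        + V x * ψ (xw - x) x ^ 2)
      ≤ (α₀ / 2) * ∫ x in b..xe,
        ((deriv (fun τ => ψ τ x) 0 - deriv (ψ 0) x) ^ 2 + V x * ψ 0 x ^ 2) := by
  have hVc : Continuous V := hV.continuous
  have hV'c : Continuous (deriv V) := hV.continuous_deriv (by norm_num)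
  obtain ⟨ψt, ψx, -, -, -, hct, hcx, -, -, -, h1, h2, -⟩ := exists_partials_of_contDiff_two hψ
  have hd1 : ∀ t x, deriv (fun τ => ψ τ x) t = ψt t x := fun t x => (h1 t x).deriv
  have hd2 : ∀ t x, deriv (ψ t) x = ψx t x := fun t x => (h2 t x).deriv
  have hψ' : Continuous fun p : ℝ × ℝ => ψ p.1 p.2 := hψ.continuous
  have hψt' : Continuous fun p : ℝ × ℝ => ψt p.1 p.2 := hct
  have hψx' : Continuous fun p : ℝ × ℝ => ψx p.1 p.2 := hcx
  -- the smooth continuation of the optimal weight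
  set β₂ : ℝ → ℝ := fun v => α₀ * (1 - Real.exp (-(κ * (v - xe)))) with hβ₂
  have hβC : ContDiff ℝ 1 β₂ := by simp only [hβ₂]; fun_prop
  have hβc : Continuous β₂ := hβC.continuous
  have hβd : ∀ v, HasDerivAt β₂ (κ * (α₀ - β₂ v)) v := by
    intro v
    have hin : HasDerivAt (fun v => -(κ * (v - xe))) (-(κ * 1)) v :=
      (((hasDerivAt_id v).sub_const xe).const_mul κ).neg
    have hE := (Real.hasDerivAt_exp _).comp v hin
    have h := ((hasDerivAt_const v (1 : ℝ)).sub hE).const_mul α₀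
    refine h.congr_deriv ?_
    simp only [hβ₂]
    ring
  have hβ' : ∀ v, deriv β₂ v = κ * (α₀ - β₂ v) := fun v => (hβd v).deriv
  have hβ'c : Continuous (deriv β₂) := by
    have : deriv β₂ = fun v => κ * (α₀ - β₂ v) := funext hβ'
    rw [this]; fun_prop
  have hαβ : ∀ v, 0 ≤ α₀ - β₂ v := fun v => by
    simp only [hβ₂]
    have := Real.exp_pos (-(κ * (v - xe)))
    nlinarith
  have hβpos : ∀ v, xe ≤ v → 0 ≤ β₂ v := fun v hv => by
    simp only [hβ₂]
    apply mul_nonneg hα0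
    rw [sub_nonneg, Real.exp_le_one_iff]
    nlinarith
  have hβe : β₂ xe = 0 := by simp [hβ₂]
  have hβw : 1 ≤ β₂ xw := by simpa only [hβ₂] using hαw
  have hα1 : 1 ≤ α₀ := by
    have hle : α₀ * (1 - Real.exp (-(κ * (xw - xe)))) ≤ α₀ * 1 := by
      apply mul_le_mul_of_nonneg_left _ hα0
      linarith [Real.exp_pos (-(κ * (xw - xe)))]
    linarith
  -- the three identities
  have IB := wave1D_nullMultiplier_trapezoid_identity (α := fun _ => α₀) (β := β₂) hV contDiff_const
    hβC hψ hsol (a := b) (b := xw) (s := 0) (t := t) ht (by linarith)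
  have IS := wave1D_nullMultiplier_trapezoid_identity (α := fun _ => α₀) (β := β₂) hV contDiff_const
    hβC hψ hsol (a := b) (b := xe) (s := 0) (t := t) ht hb
  have IZ := wave1D_nullMultiplier_trapezoid_identity (α := fun _ => α₀) (β := fun _ => (0 : ℝ)) hV
    contDiff_const contDiff_const hψ hsol (a := b) (b := xe) (s := 0) (t := t) ht hb
  simp only [zero_add, add_zero, sub_zero, deriv_const', mul_zero, zero_mul, hd1, hd2] at IB IS IZ
  simp only [hd1, hd2]
  -- (f1) the big top = the small top + the strip top, the latter non-negative
  have hcT : Continuous fun x => β₂ (t + x) * (ψt t x + ψx t x) ^ 2 + α₀ * (ψt t x - ψx t x) ^ 2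
      + (α₀ + β₂ (t + x)) * V x * ψ t x ^ 2 := by fun_prop
  have f1 : (∫ x in (b + t)..(xw - t), (β₂ (t + x) * (ψt t x + ψx t x) ^ 2
        + α₀ * (ψt t x - ψx t x) ^ 2 + (α₀ + β₂ (t + x)) * V x * ψ t x ^ 2))
      = (∫ x in (b + t)..(xe - t), (β₂ (t + x) * (ψt t x + ψx t x) ^ 2
          + α₀ * (ψt t x - ψx t x) ^ 2 + (α₀ + β₂ (t + x)) * V x * ψ t x ^ 2))
        + ∫ x in (xe - t)..(xw - t), (β₂ (t + x) * (ψt t x + ψx t x) ^ 2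
          + α₀ * (ψt t x - ψx t x) ^ 2 + (α₀ + β₂ (t + x)) * V x * ψ t x ^ 2) :=
    (integral_add_adjacent_intervals (hcT.intervalIntegrable _ _) (hcT.intervalIntegrable _ _)).symm
  have f1' : 0 ≤ ∫ x in (xe - t)..(xw - t), (β₂ (t + x) * (ψt t x + ψx t x) ^ 2
      + α₀ * (ψt t x - ψx t x) ^ 2 + (α₀ + β₂ (t + x)) * V x * ψ t x ^ 2) :=
    intervalIntegral.integral_nonneg (by linarith) fun x hx => by
      have hb2 : 0 ≤ β₂ (t + x) := hβpos _ (by linarith [hx.1])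
      have hv := hV0 x
      positivity
  -- (f2) the big base = the small base (the data vanish on `[xe, xw]`)
  have hc0 : Continuous fun x => β₂ x * (ψt 0 x + ψx 0 x) ^ 2 + α₀ * (ψt 0 x - ψx 0 x) ^ 2
      + (α₀ + β₂ x) * V x * ψ 0 x ^ 2 := by fun_prop
  have hzero : ∀ x, xe < x → ψ 0 x = 0 ∧ ψt 0 x = 0 ∧ ψx 0 x = 0 := by
    intro x hx
    refine ⟨(hsupp x hx.le).1, by rw [← hd1]; exact (hsupp x hx.le).2, ?_⟩
    rw [← hd2]
    have hev : (ψ 0) =ᶠ[𝓝 x] fun _ => (0 : ℝ) := by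
      filter_upwards [Ioi_mem_nhds hx] with y hy using (hsupp y (le_of_lt hy)).1
    rw [hev.deriv_eq, deriv_const]
  have f2 : (∫ x in b..xw, (β₂ x * (ψt 0 x + ψx 0 x) ^ 2 + α₀ * (ψt 0 x - ψx 0 x) ^ 2
        + (α₀ + β₂ x) * V x * ψ 0 x ^ 2))
      = ∫ x in b..xe, (β₂ x * (ψt 0 x + ψx 0 x) ^ 2 + α₀ * (ψt 0 x - ψx 0 x) ^ 2
        + (α₀ + β₂ x) * V x * ψ 0 x ^ 2) := by
    rw [← integral_add_adjacent_intervals (hc0.intervalIntegrable b xe) (hc0.intervalIntegrable xe xw)]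
    have hz : (∫ x in xe..xw, (β₂ x * (ψt 0 x + ψx 0 x) ^ 2 + α₀ * (ψt 0 x - ψx 0 x) ^ 2
        + (α₀ + β₂ x) * V x * ψ 0 x ^ 2)) = 0 := by
      rw [integral_of_le hew]
      refine setIntegral_eq_zero_of_forall_eq_zero fun x hx => ?_
      obtain ⟨h0, ht0, hx0⟩ := hzero x hx.1
      simp [h0, ht0, hx0]
    rw [hz, add_zero]
  -- (f3) the small roof with `β₂` = the small roof with `β ≡ 0` (`β₂ xe = 0`)
  have f3 : (∫ x in (xe - t)..xe, (2 * α₀ * (ψt (xe - x) x - ψx (xe - x) x) ^ 2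
        + 2 * β₂ xe * V x * ψ (xe - x) x ^ 2))
      = ∫ x in (xe - t)..xe, 2 * α₀ * (ψt (xe - x) x - ψx (xe - x) x) ^ 2 := by
    refine integral_congr fun x _ => ?_
    simp only [hβe]
    ring
  -- (f4) the big bulk = the small bulk + the strip bulk, the latter non-positive
  set S : ℝ → ℝ → ℝ := fun τ x =>
    (2 * deriv β₂ (τ + x) * V x + (β₂ (τ + x) - α₀) * deriv V x) * ψ τ x ^ 2 with hS
  have hSc : Continuous (Function.uncurry S) := by
    show Continuous fun p : ℝ × ℝ =>
      (2 * deriv β₂ (p.1 + p.2) * V p.2 + (β₂ (p.1 + p.2) - α₀) * deriv V p.2) * ψ p.1 p.2 ^ 2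
    fun_prop
  have hSnp : ∀ τ x, x ≤ xw → S τ x ≤ 0 := by
    intro τ x hx
    simp only [hS, hβ']
    have h1' := hmono x hx
    have h2' := hαβ (τ + x)
    have h3' := hV0 x
    have hco : 2 * (κ * (α₀ - β₂ (τ + x))) * V x + (β₂ (τ + x) - α₀) * deriv V x ≤ 0 := by
      nlinarith [mul_le_mul_of_nonneg_left h1' h2']
    exact mul_nonpos_of_nonpos_of_nonneg hco (sq_nonneg _)
  have hGc : Continuous fun τ => ∫ x in (b + τ)..(xe - τ), S τ x :=
    continuous_trapezoidSlice_integral hSc b xe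
  have hHc : Continuous fun τ => ∫ x in (xe + τ)..(xw - τ), S τ x :=
    continuous_trapezoidSlice_integral hSc xe xw
  have hinner : ∀ τ, (∫ x in (b + τ)..(xw - τ), S τ x)
      = (∫ x in (b + τ)..(xe - τ), S τ x) + ∫ x in (xe - τ)..(xw - τ), S τ x := by
    intro τ
    have hc : Continuous fun x => S τ x := hSc.comp (continuous_const.prodMk continuous_id)
    exact (integral_add_adjacent_intervals (hc.intervalIntegrable _ _) (hc.intervalIntegrable _ _)).symm
  have f4 : (∫ τ in (0 : ℝ)..t, ∫ x in (b + τ)..(xw - τ), S τ x)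
      = (∫ τ in (0 : ℝ)..t, ∫ x in (b + τ)..(xe - τ), S τ x)
        + ∫ τ in (0 : ℝ)..t, ∫ x in (xe - τ)..(xw - τ), S τ x := by
    have hH' : Continuous fun τ => ∫ x in (xe - τ)..(xw - τ), S τ x := by
      have heq : (fun τ => ∫ x in (xe - τ)..(xw - τ), S τ x)
          = fun τ => ∫ x in (xe + (-τ))..(xw - τ), S τ x := by
        funext τ; rw [← sub_eq_add_neg]
      have h1 : Continuous fun τ => ∫ x in (0 : ℝ)..(xw - τ), S τ x :=
        intervalIntegral.continuous_parametric_intervalIntegral_of_continuous hSc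
          (continuous_const.sub continuous_id)
      have h2 : Continuous fun τ => ∫ x in (0 : ℝ)..(xe - τ), S τ x :=
        intervalIntegral.continuous_parametric_intervalIntegral_of_continuous hSc
          (continuous_const.sub continuous_id)
      have heq2 : (fun τ => ∫ x in (xe - τ)..(xw - τ), S τ x)
          = fun τ => (∫ x in (0 : ℝ)..(xw - τ), S τ x) - ∫ x in (0 : ℝ)..(xe - τ), S τ x := by
        funext τ
        have hc : Continuous fun x => S τ x := hSc.comp (continuous_const.prodMk continuous_id)
        rw [integral_interval_sub_left (hc.intervalIntegrable _ _) (hc.intervalIntegrable _ _)]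
      rw [heq2]
      exact h1.sub h2
    rw [← integral_add (hGc.intervalIntegrable _ _) (hH'.intervalIntegrable _ _)]
    exact integral_congr fun τ _ => hinner τ
  have f4' : (∫ τ in (0 : ℝ)..t, ∫ x in (xe - τ)..(xw - τ), S τ x) ≤ 0 := by
    rw [integral_of_le ht]
    refine setIntegral_nonpos measurableSet_Ioc fun τ hτ => ?_
    rw [integral_of_le (by linarith)]
    exact setIntegral_nonpos measurableSet_Ioc fun x hx => hSnp τ x (by linarith [hx.2, hτ.1])
  -- (f5) signs of the `β ≡ 0` identity
  have f5T : 0 ≤ ∫ x in (b + t)..(xe - t), (α₀ * (ψt t x - ψx t x) ^ 2 + α₀ * V x * ψ t x ^ 2) :=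
    intervalIntegral.integral_nonneg hb fun x _ => by
      have := hV0 x; positivity
  have f5L : 0 ≤ ∫ x in b..(b + t), 2 * α₀ * V x * ψ (x - b) x ^ 2 :=
    intervalIntegral.integral_nonneg (by linarith) fun x _ => by
      have := hV0 x; positivity
  have f5K : (∫ τ in (0 : ℝ)..t, ∫ x in (b + τ)..(xe - τ), (0 - α₀) * deriv V x * ψ τ x ^ 2) ≤ 0 := by
    rw [integral_of_le ht]
    refine setIntegral_nonpos measurableSet_Ioc fun τ hτ => ?_
    have hτt : τ ≤ t := hτ.2
    rw [integral_of_le (by linarith)]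
    refine setIntegral_nonpos measurableSet_Ioc fun x hx => ?_
    have hxw : x ≤ xw := by linarith [hx.2, hτ.1]
    have hV' : 0 ≤ deriv V x := le_trans (by have := hV0 x; positivity) (hmono x hxw)
    have : (0 - α₀) * deriv V x ≤ 0 := by nlinarith
    exact mul_nonpos_of_nonpos_of_nonneg this (sq_nonneg _)
  -- (f6) the big roof dominates twice the energy flux
  have hcR : Continuous fun x => (ψt (xw - x) x - ψx (xw - x) x) ^ 2 + V x * ψ (xw - x) x ^ 2 := by
    fun_prop
  have hcR' : Continuous fun x => 2 * α₀ * (ψt (xw - x) x - ψx (xw - x) x) ^ 2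
      + 2 * β₂ xw * V x * ψ (xw - x) x ^ 2 := by fun_prop
  have f6 : 2 * ∫ x in (xw - t)..xw, ((ψt (xw - x) x - ψx (xw - x) x) ^ 2 + V x * ψ (xw - x) x ^ 2)
      ≤ ∫ x in (xw - t)..xw, (2 * α₀ * (ψt (xw - x) x - ψx (xw - x) x) ^ 2
          + 2 * β₂ xw * V x * ψ (xw - x) x ^ 2) := by
    rw [← intervalIntegral.integral_const_mul]
    refine intervalIntegral.integral_mono_on (by linarith) ((hcR.const_mul 2).intervalIntegrable _ _)
      (hcR'.intervalIntegrable _ _) fun x _ => ?_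
    have hv := hV0 x
    have hsq := sq_nonneg (ψt (xw - x) x - ψx (xw - x) x)
    have hψ2 := sq_nonneg (ψ (xw - x) x)
    nlinarith [mul_nonneg hv hψ2, mul_le_mul_of_nonneg_right hα1 hsq,
      mul_le_mul_of_nonneg_right hβw (mul_nonneg hv hψ2)]
  -- the base of the `β ≡ 0` identity is `α₀ ×` the right-hand side
  have f7 : (∫ x in b..xe, (α₀ * (ψt 0 x - ψx 0 x) ^ 2 + α₀ * V x * ψ 0 x ^ 2))
      = α₀ * ∫ x in b..xe, ((ψt 0 x - ψx 0 x) ^ 2 + V x * ψ 0 x ^ 2) := by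
    rw [← intervalIntegral.integral_const_mul]
    refine integral_congr fun x _ => ?_
    ring
  -- combine
  simp only [hS] at f4 f4' hinner
  rw [f1, f2, f4] at IB
  rw [f3] at IS
  rw [f7] at IZ
  linarith [IB, IS, IZ, f1', f4', f5T, f5L, f5K, f6]

/-- **Sharp forward windowed estimate.** Under the hypotheses of `wave1D_roofFlux_le_sharp`, if the
time-`0` energy below the window top is finite, then for every `t ≥ 0`
`ofReal (∫_{x ≤ x_w} e(0,·) − (α₀/2) ∫_{x ≤ x_e} [(ψ_t − ψ_x)² + Vψ²](0,·)) ≤ ∫⁻_{x < x_w − t} e(t,·)`.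
[folklore] -/
theorem wave1D_nearWindow_forward_ge_sharp (hV : ContDiff ℝ 1 V) (hV0 : ∀ x, 0 ≤ V x) {κ xe xw : ℝ}
    (hκ : 0 ≤ κ) (hmono : ∀ x, x ≤ xw → 2 * κ * V x ≤ deriv V x) (hew : xe ≤ xw) {α₀ : ℝ}
    (hα0 : 0 ≤ α₀) (hαw : 1 ≤ α₀ * (1 - Real.exp (-(κ * (xw - xe)))))
    (hψ : ContDiff ℝ 2 (Function.uncurry ψ))
    (hsol : ∀ t x, iteratedDeriv 2 (fun τ => ψ τ x) t - iteratedDeriv 2 (ψ t) x + V x * ψ t x = 0)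
    (hsupp : ∀ x, xe ≤ x → ψ 0 x = 0 ∧ deriv (fun τ => ψ τ x) 0 = 0)
    (hfin : ∫⁻ x in Iic xw, ENNReal.ofReal
        (deriv (fun τ => ψ τ x) 0 ^ 2 + deriv (ψ 0) x ^ 2 + V x * ψ 0 x ^ 2) ≠ ⊤)
    {t : ℝ} (ht : 0 ≤ t) :
    ENNReal.ofReal ((∫ x in Iic xw,
        (deriv (fun τ => ψ τ x) 0 ^ 2 + deriv (ψ 0) x ^ 2 + V x * ψ 0 x ^ 2))
          - (α₀ / 2) * ∫ x in Iic xe,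
            ((deriv (fun τ => ψ τ x) 0 - deriv (ψ 0) x) ^ 2 + V x * ψ 0 x ^ 2))
      ≤ ∫⁻ x in Iio (xw - t), ENNReal.ofReal
        (deriv (fun τ => ψ τ x) t ^ 2 + deriv (ψ t) x ^ 2 + V x * ψ t x ^ 2) := by
  have hVc : Continuous V := hV.continuous
  obtain ⟨ψt, ψx, -, -, -, hct, hcx, -, -, -, h1, h2, -⟩ := exists_partials_of_contDiff_two hψ
  have hd1 : ∀ t x, deriv (fun τ => ψ τ x) t = ψt t x := fun t x => (h1 t x).deriv
  have hd2 : ∀ t x, deriv (ψ t) x = ψx t x := fun t x => (h2 t x).deriv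
  set e0 : ℝ → ℝ := fun x => deriv (fun τ => ψ τ x) 0 ^ 2 + deriv (ψ 0) x ^ 2 + V x * ψ 0 x ^ 2
    with he0
  set Z0 : ℝ → ℝ := fun x => (deriv (fun τ => ψ τ x) 0 - deriv (ψ 0) x) ^ 2 + V x * ψ 0 x ^ 2
    with hZ0
  have he0_nn : ∀ x, 0 ≤ e0 x := fun x => wave1D_energyDensity_nonneg hV0 0 x
  have hZ0_nn : ∀ x, 0 ≤ Z0 x := fun x => by
    simp only [hZ0]; have := hV0 x; positivity
  have hZ0_le : ∀ x, Z0 x ≤ 2 * e0 x := fun x => by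
    simp only [hZ0, he0]
    have hv := hV0 x
    nlinarith [sq_nonneg (deriv (fun τ => ψ τ x) 0 + deriv (ψ 0) x),
      mul_nonneg hv (sq_nonneg (ψ 0 x))]
  have he0_cont : Continuous e0 := by
    simp only [he0, hd1, hd2]
    have ha : Continuous fun p : ℝ × ℝ => ψt p.1 p.2 := hct
    have hb' : Continuous fun p : ℝ × ℝ => ψx p.1 p.2 := hcx
    have hc : Continuous fun p : ℝ × ℝ => ψ p.1 p.2 := hψ.continuous
    fun_prop
  have hZ0_cont : Continuous Z0 := by
    simp only [hZ0, hd1, hd2]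
    have ha : Continuous fun p : ℝ × ℝ => ψt p.1 p.2 := hct
    have hb' : Continuous fun p : ℝ × ℝ => ψx p.1 p.2 := hcx
    have hc : Continuous fun p : ℝ × ℝ => ψ p.1 p.2 := hψ.continuous
    fun_prop
  have he0_int : IntegrableOn e0 (Iic xw) := by
    refine ⟨he0_cont.aestronglyMeasurable, ?_⟩
    rw [hasFiniteIntegral_iff_ofReal (ae_of_all _ fun x => he0_nn x)]
    exact lt_top_iff_ne_top.2 hfin
  have he0_int' : IntegrableOn e0 (Iic xe) := he0_int.mono_set (Iic_subset_Iic.2 hew)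
  have hZ0_int : IntegrableOn Z0 (Iic xe) := by
    refine Integrable.mono' (he0_int'.const_mul 2) hZ0_cont.aestronglyMeasurable
      (ae_of_all _ fun x => ?_)
    rw [Real.norm_eq_abs, abs_of_nonneg (hZ0_nn x)]
    exact hZ0_le x
  set R : ℝ := (α₀ / 2) * ∫ x in Iic xe, Z0 x with hR
  have htrunc : ∀ y, y ≤ xe →
      ENNReal.ofReal ((∫ x in y..xw, e0 x) - R)
        ≤ ∫⁻ x in Iio (xw - t), ENNReal.ofReal
          (deriv (fun τ => ψ τ x) t ^ 2 + deriv (ψ t) x ^ 2 + V x * ψ t x ^ 2) := by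
    intro y hy
    have hb : (y - 2 * t) + 2 * t ≤ xw := by linarith
    have hge := wave1D_truncated_energy_ge hVc hV0 hψ hsol (a := xw) (b := y - 2 * t) ht hb
    have hroof := wave1D_roofFlux_le_sharp hV hV0 hκ hmono hew hα0 hαw hψ hsol hsupp
      (b := y - 2 * t) ht (by linarith)
    have hZmono : (∫ x in (y - 2 * t)..xe, Z0 x) ≤ ∫ x in Iic xe, Z0 x := by
      rw [integral_of_le (by linarith)]
      exact setIntegral_mono_set hZ0_int (ae_of_all _ fun x => hZ0_nn x)
        (ae_of_all _ Ioc_subset_Iic_self)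
    have hy2 : y - 2 * t + 2 * t = y := by ring
    rw [hy2] at hge
    have hα2 : 0 ≤ α₀ / 2 := by linarith
    have hstep : (∫ x in y..xw, e0 x) - R
        ≤ ∫ x in (y - 2 * t + t)..(xw - t),
          (deriv (fun τ => ψ τ x) t ^ 2 + deriv (ψ t) x ^ 2 + V x * ψ t x ^ 2) := by
      simp only [hR, he0]
      have hZ : (∫ x in (y - 2 * t)..xe, Z0 x) = ∫ x in (y - 2 * t)..xe,
          ((deriv (fun τ => ψ τ x) 0 - deriv (ψ 0) x) ^ 2 + V x * ψ 0 x ^ 2) := by simp only [hZ0]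
      rw [← hZ] at hroof
      nlinarith [mul_le_mul_of_nonneg_left hZmono hα2]
    calc ENNReal.ofReal ((∫ x in y..xw, e0 x) - R)
        ≤ ENNReal.ofReal (∫ x in (y - 2 * t + t)..(xw - t),
            (deriv (fun τ => ψ τ x) t ^ 2 + deriv (ψ t) x ^ 2 + V x * ψ t x ^ 2)) :=
          ENNReal.ofReal_le_ofReal hstep
      _ = ∫⁻ x in Ioc (y - 2 * t + t) (xw - t), ENNReal.ofReal
            (deriv (fun τ => ψ τ x) t ^ 2 + deriv (ψ t) x ^ 2 + V x * ψ t x ^ 2) :=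
          (lintegral_Ioc_wave1D_energy_eq hVc hV0 hψ t (by linarith)).symm
      _ ≤ ∫⁻ x in Iic (xw - t), ENNReal.ofReal
            (deriv (fun τ => ψ τ x) t ^ 2 + deriv (ψ t) x ^ 2 + V x * ψ t x ^ 2) :=
          lintegral_mono_set Ioc_subset_Iic_self
      _ = ∫⁻ x in Iio (xw - t), ENNReal.ofReal
            (deriv (fun τ => ψ τ x) t ^ 2 + deriv (ψ t) x ^ 2 + V x * ψ t x ^ 2) :=
          (setLIntegral_congr (Iio_ae_eq_Iic (μ := volume) (a := xw - t))).symm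
  have hlim : Tendsto (fun y => ENNReal.ofReal ((∫ x in y..xw, e0 x) - R)) atBot
      (𝓝 (ENNReal.ofReal ((∫ x in Iic xw, e0 x) - R))) := by
    have h1 : Tendsto (fun y => ∫ x in y..xw, e0 x) atBot (𝓝 (∫ x in Iic xw, e0 x)) :=
      intervalIntegral_tendsto_integral_Iic xw he0_int tendsto_id
    exact ENNReal.continuous_ofReal.continuousAt.tendsto.comp (h1.sub_const R)
  have hmain := le_of_tendsto hlim (Filter.Eventually.mono (eventually_le_atBot xe) htrunc)
  simpa only [hR, he0, hZ0] using hmain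

/-- **Sharp windowed channel inequality on the growing side of the potential.** Let `V ∈ C¹`,
`V ≥ 0`, `κ > 0`, `V′ ≥ 2κV` on `(−∞, x_w]`, and let `ψ` be a global `C²` solution of
`ψ_tt − ψ_xx + V(x)ψ = 0` whose Cauchy data vanish on `[x_w − h, ∞)`, `h > 0`. Then, with
`e = ψ_t² + ψ_x² + Vψ²` and `λ = e^{κh}`,
`((λ − 2)/(λ − 1)) · ∫ e(0,·) ≤ liminf_{t→+∞} ∫_{x < x_w − t} e(t,·) + liminf_{t→−∞} ∫_{x < x_w + t} e(t,·)`,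
written with `(λ−2)/(λ−1) = (1 − 2e^{−κh})/(1 − e^{−κh})` (lower Lebesgue integrals; infinite energy
allowed). Positive constant iff `κh > log 2`: in the exact model `V′ = 2κV`, `κ = 1/4M`, this is the
lag threshold `h > 4M log 2`. [folklore] -/
theorem wave1D_nearWindowedChannel_sharp (hV : ContDiff ℝ 1 V) (hV0 : ∀ x, 0 ≤ V x) {κ xw h : ℝ}
    (hκ : 0 < κ) (hh : 0 < h) (hmono : ∀ x, x ≤ xw → 2 * κ * V x ≤ deriv V x)
    (hψ : ContDiff ℝ 2 (Function.uncurry ψ))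
    (hsol : ∀ t x, iteratedDeriv 2 (fun τ => ψ τ x) t - iteratedDeriv 2 (ψ t) x + V x * ψ t x = 0)
    (hsupp : ∀ x, xw - h ≤ x → ψ 0 x = 0 ∧ deriv (fun τ => ψ τ x) 0 = 0) :
    ENNReal.ofReal ((1 - 2 * Real.exp (-(κ * h))) / (1 - Real.exp (-(κ * h))))
        * ∫⁻ x, ENNReal.ofReal (deriv (fun τ => ψ τ x) 0 ^ 2 + deriv (ψ 0) x ^ 2 + V x * ψ 0 x ^ 2)
      ≤ liminf (fun t => ∫⁻ x in Iio (xw - t), ENNReal.ofReal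
            (deriv (fun τ => ψ τ x) t ^ 2 + deriv (ψ t) x ^ 2 + V x * ψ t x ^ 2)) atTop
        + liminf (fun t => ∫⁻ x in Iio (xw + t), ENNReal.ofReal
            (deriv (fun τ => ψ τ x) t ^ 2 + deriv (ψ t) x ^ 2 + V x * ψ t x ^ 2)) atBot := by
  have hVc : Continuous V := hV.continuous
  obtain ⟨ψt, ψx, -, -, -, hct, hcx, -, -, -, h1, h2, -⟩ := exists_partials_of_contDiff_two hψ
  have hd1 : ∀ t x, deriv (fun τ => ψ τ x) t = ψt t x := fun t x => (h1 t x).deriv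
  have hd2 : ∀ t x, deriv (ψ t) x = ψx t x := fun t x => (h2 t x).deriv
  set xe : ℝ := xw - h with hxe
  have hew : xe ≤ xw := by simp only [hxe]; linarith
  set e0 : ℝ → ℝ := fun x => deriv (fun τ => ψ τ x) 0 ^ 2 + deriv (ψ 0) x ^ 2 + V x * ψ 0 x ^ 2
    with he0
  have he0_nn : ∀ x, 0 ≤ e0 x := fun x => wave1D_energyDensity_nonneg hV0 0 x
  have he0_cont : Continuous e0 := by
    simp only [he0, hd1, hd2]
    have ha : Continuous fun p : ℝ × ℝ => ψt p.1 p.2 := hct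
    have hb' : Continuous fun p : ℝ × ℝ => ψx p.1 p.2 := hcx
    have hc : Continuous fun p : ℝ × ℝ => ψ p.1 p.2 := hψ.continuous
    fun_prop
  have he0_zero : ∀ x, xe < x → e0 x = 0 := by
    intro x hx
    have hψ0 : ψ 0 x = 0 := (hsupp x hx.le).1
    have hψt0 : deriv (fun τ => ψ τ x) 0 = 0 := (hsupp x hx.le).2
    have hψx0 : deriv (ψ 0) x = 0 := by
      have hev : (ψ 0) =ᶠ[𝓝 x] fun _ => (0 : ℝ) := by
        filter_upwards [Ioi_mem_nhds hx] with y hy using (hsupp y (le_of_lt hy)).1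
      rw [hev.deriv_eq, deriv_const]
    simp only [he0, hψ0, hψt0, hψx0]
    ring
  -- infinite energy
  by_cases htop : ∫⁻ x in Iio xw, ENNReal.ofReal (e0 x) = ⊤
  · have hfw : ∀ t, 0 ≤ t → (∫⁻ x in Iio (xw - t), ENNReal.ofReal
        (deriv (fun τ => ψ τ x) t ^ 2 + deriv (ψ t) x ^ 2 + V x * ψ t x ^ 2)) = ⊤ := fun t ht =>
      wave1D_lintegral_Iio_energy_eq_top_of_nonneg hVc hV0 hψ hsol htop ht
    have hlim : liminf (fun t => ∫⁻ x in Iio (xw - t), ENNReal.ofReal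
        (deriv (fun τ => ψ τ x) t ^ 2 + deriv (ψ t) x ^ 2 + V x * ψ t x ^ 2)) atTop = ⊤ := by
      refine top_unique (le_liminf_of_le (h := ?_))
      filter_upwards [eventually_ge_atTop 0] with t ht
      exact (hfw t ht).ge
    rw [hlim, top_add]
    exact le_top
  have hfinIic : ∫⁻ x in Iic xw, ENNReal.ofReal (e0 x) ≠ ⊤ := by
    rwa [← setLIntegral_congr (Iio_ae_eq_Iic (μ := volume) (a := xw))]
  -- the weight constant
  set q : ℝ := Real.exp (-(κ * h)) with hq
  have hq1 : q < 1 := by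
    rw [hq, Real.exp_lt_one_iff]
    nlinarith
  have hqpos : 0 < q := Real.exp_pos _
  set α₀ : ℝ := 1 / (1 - q) with hα₀
  have hα0 : 0 ≤ α₀ := by simp only [hα₀]; exact div_nonneg zero_le_one (by linarith)
  have hαw : 1 ≤ α₀ * (1 - Real.exp (-(κ * (xw - xe)))) := by
    have : xw - xe = h := by simp only [hxe]; ring
    rw [this, ← hq, hα₀, div_mul_cancel₀ (1 : ℝ) (by linarith : (1 - q) ≠ 0)]
  -- forward estimates for `ψ` and its time reversal
  have hF := fun (t : ℝ) (ht : 0 ≤ t) =>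
    wave1D_nearWindow_forward_ge_sharp hV hV0 hκ.le hmono hew hα0 hαw hψ hsol hsupp hfinIic ht
  obtain ⟨hψ', hsol', he'⟩ := wave1D_timeReversal hψ hsol
  have hdn : ∀ x, deriv (fun τ => (fun t x => ψ (-t) x) τ x) 0 = -deriv (fun τ => ψ τ x) 0 := by
    intro x
    have := deriv_comp_neg (fun τ => ψ τ x) 0
    simpa using this
  have hsupp' : ∀ x, xe ≤ x → (fun t x => ψ (-t) x) 0 x = 0
      ∧ deriv (fun τ => (fun t x => ψ (-t) x) τ x) 0 = 0 := by
    intro x hx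
    refine ⟨by simpa using (hsupp x hx).1, ?_⟩
    rw [hdn x, (hsupp x hx).2, neg_zero]
  have hfinIic' : ∫⁻ x in Iic xw, ENNReal.ofReal (deriv (fun τ => (fun t x => ψ (-t) x) τ x) 0 ^ 2
      + deriv ((fun t x => ψ (-t) x) 0) x ^ 2 + V x * (fun t x => ψ (-t) x) 0 x ^ 2) ≠ ⊤ := by
    simp only [he', neg_zero]
    exact hfinIic
  have hB := fun (t : ℝ) (ht : 0 ≤ t) =>
    wave1D_nearWindow_forward_ge_sharp hV hV0 hκ.le hmono hew hα0 hαw hψ' hsol' hsupp' hfinIic' ht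
  set Ew : ℝ := ∫ x in Iic xw, e0 x with hEw
  set Rp : ℝ := (α₀ / 2) * ∫ x in Iic xe,
    ((deriv (fun τ => ψ τ x) 0 - deriv (ψ 0) x) ^ 2 + V x * ψ 0 x ^ 2) with hRp
  set Rm : ℝ := (α₀ / 2) * ∫ x in Iic xe,
    ((-deriv (fun τ => ψ τ x) 0 - deriv (ψ 0) x) ^ 2 + V x * ψ 0 x ^ 2) with hRm
  have hfwd : ENNReal.ofReal (Ew - Rp) ≤ liminf (fun t => ∫⁻ x in Iio (xw - t), ENNReal.ofReal
      (deriv (fun τ => ψ τ x) t ^ 2 + deriv (ψ t) x ^ 2 + V x * ψ t x ^ 2)) atTop := by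
    refine le_liminf_of_le (h := ?_)
    filter_upwards [eventually_ge_atTop 0] with t ht
    exact hF t ht
  have hbwd : ENNReal.ofReal (Ew - Rm) ≤ liminf (fun t => ∫⁻ x in Iio (xw + t), ENNReal.ofReal
      (deriv (fun τ => ψ τ x) t ^ 2 + deriv (ψ t) x ^ 2 + V x * ψ t x ^ 2)) atBot := by
    refine le_liminf_of_le (h := ?_)
    filter_upwards [eventually_le_atBot 0] with t ht
    have hb := hB (-t) (by linarith)
    simp only [he', neg_neg, neg_zero, hdn] at hb
    have hset : xw - -t = xw + t := by ring
    rw [hset] at hb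
    refine le_trans (le_of_eq ?_) (le_of_le_of_eq hb rfl)
    congr 1
    rw [hEw, hRm]
    congr 1
    simp only [he0]
    congr 1
    funext x
    ring
  -- energy bookkeeping at time `0`
  have he0_int : IntegrableOn e0 (Iic xw) := by
    refine ⟨he0_cont.aestronglyMeasurable, ?_⟩
    rw [hasFiniteIntegral_iff_ofReal (ae_of_all _ fun x => he0_nn x)]
    exact lt_top_iff_ne_top.2 hfinIic
  have he0_int' : IntegrableOn e0 (Iic xe) := he0_int.mono_set (Iic_subset_Iic.2 hew)
  set Ee : ℝ := ∫ x in Iic xe, e0 x with hEe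
  have hEwe : Ew = Ee := by
    rw [hEw, hEe, ← Iic_union_Ioc_eq_Iic hew,
      setIntegral_union (Iic_disjoint_Ioc le_rfl) measurableSet_Ioc he0_int'
        (he0_int.mono_set Ioc_subset_Iic_self)]
    have hz : (∫ x in Ioc xe xw, e0 x) = 0 :=
      setIntegral_eq_zero_of_forall_eq_zero fun x hx => he0_zero x hx.1
    rw [hz, add_zero]
  have hsum : Rp + Rm = α₀ * Ee := by
    have hc1 : Continuous fun x => (deriv (fun τ => ψ τ x) 0 - deriv (ψ 0) x) ^ 2 + V x * ψ 0 x ^ 2 := by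
      simp only [hd1, hd2]
      have ha : Continuous fun p : ℝ × ℝ => ψt p.1 p.2 := hct
      have hb' : Continuous fun p : ℝ × ℝ => ψx p.1 p.2 := hcx
      have hc : Continuous fun p : ℝ × ℝ => ψ p.1 p.2 := hψ.continuous
      fun_prop
    have hc2 : Continuous fun x => (-deriv (fun τ => ψ τ x) 0 - deriv (ψ 0) x) ^ 2 + V x * ψ 0 x ^ 2 := by
      simp only [hd1, hd2]
      have ha : Continuous fun p : ℝ × ℝ => ψt p.1 p.2 := hct
      have hb' : Continuous fun p : ℝ × ℝ => ψx p.1 p.2 := hcx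
      have hc : Continuous fun p : ℝ × ℝ => ψ p.1 p.2 := hψ.continuous
      fun_prop
    have hle1 : ∀ x, |(deriv (fun τ => ψ τ x) 0 - deriv (ψ 0) x) ^ 2 + V x * ψ 0 x ^ 2| ≤ 2 * e0 x := by
      intro x
      have hv := hV0 x
      rw [abs_of_nonneg (by positivity)]
      simp only [he0]
      nlinarith [sq_nonneg (deriv (fun τ => ψ τ x) 0 + deriv (ψ 0) x), mul_nonneg hv (sq_nonneg (ψ 0 x))]
    have hle2 : ∀ x, |(-deriv (fun τ => ψ τ x) 0 - deriv (ψ 0) x) ^ 2 + V x * ψ 0 x ^ 2| ≤ 2 * e0 x := by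
      intro x
      have hv := hV0 x
      rw [abs_of_nonneg (by positivity)]
      simp only [he0]
      nlinarith [sq_nonneg (-deriv (fun τ => ψ τ x) 0 + deriv (ψ 0) x), mul_nonneg hv (sq_nonneg (ψ 0 x))]
    have hi1 : IntegrableOn (fun x => (deriv (fun τ => ψ τ x) 0 - deriv (ψ 0) x) ^ 2 + V x * ψ 0 x ^ 2)
        (Iic xe) :=
      Integrable.mono' (he0_int'.const_mul 2) hc1.aestronglyMeasurable
        (ae_of_all _ fun x => by rw [Real.norm_eq_abs]; exact hle1 x)
    have hi2 : IntegrableOn (fun x => (-deriv (fun τ => ψ τ x) 0 - deriv (ψ 0) x) ^ 2 + V x * ψ 0 x ^ 2)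
        (Iic xe) :=
      Integrable.mono' (he0_int'.const_mul 2) hc2.aestronglyMeasurable
        (ae_of_all _ fun x => by rw [Real.norm_eq_abs]; exact hle2 x)
    rw [hRp, hRm, ← mul_add, ← integral_add hi1 hi2, hEe]
    have hpt : (fun x => (deriv (fun τ => ψ τ x) 0 - deriv (ψ 0) x) ^ 2 + V x * ψ 0 x ^ 2
        + ((-deriv (fun τ => ψ τ x) 0 - deriv (ψ 0) x) ^ 2 + V x * ψ 0 x ^ 2))
        = fun x => 2 * e0 x := by
      funext x; simp only [he0]; ring
    rw [hpt, MeasureTheory.integral_const_mul]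
    ring
  -- the total energy is the energy below `xe`
  have htot : (∫⁻ x, ENNReal.ofReal (e0 x)) = ENNReal.ofReal Ee := by
    have hsplit := lintegral_add_compl (μ := volume) (fun x => ENNReal.ofReal (e0 x))
      (measurableSet_Iic (a := xe))
    have hzero : (∫⁻ x in (Iic xe)ᶜ, ENNReal.ofReal (e0 x)) = 0 := by
      rw [compl_Iic]
      refine setLIntegral_eq_zero measurableSet_Ioi ?_
      intro x hx
      simp [he0_zero x (mem_Ioi.1 hx)]
    rw [← hsplit, hzero, add_zero,
      ofReal_integral_eq_lintegral_ofReal he0_int' (ae_of_all _ fun x => he0_nn x)]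
  -- conclusion
  have hEe0 : 0 ≤ Ee := setIntegral_nonneg measurableSet_Iic fun x _ => he0_nn x
  have hconst : (1 - 2 * q) / (1 - q) = 2 - α₀ := by
    have h1q : (1 - q) ≠ 0 := by linarith
    rw [hα₀]
    field_simp
    ring
  rcases le_or_gt ((1 - 2 * q) / (1 - q)) 0 with hc | hc
  · rw [ENNReal.ofReal_of_nonpos hc, zero_mul]
    exact bot_le
  have hAB : (2 - α₀) * Ee ≤ (Ew - Rp) + (Ew - Rm) := by
    rw [hEwe]
    nlinarith [hsum]
  calc ENNReal.ofReal ((1 - 2 * q) / (1 - q)) * ∫⁻ x, ENNReal.ofReal (e0 x)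
      = ENNReal.ofReal ((2 - α₀) * Ee) := by
        rw [htot, hconst, ← ENNReal.ofReal_mul (by linarith [hconst ▸ hc])]
    _ ≤ ENNReal.ofReal ((Ew - Rp) + (Ew - Rm)) := ENNReal.ofReal_le_ofReal hAB
    _ ≤ ENNReal.ofReal (Ew - Rp) + ENNReal.ofReal (Ew - Rm) := ENNReal.ofReal_add_le
    _ ≤ _ := add_le_add hfwd hbwd

end Sharp

end Literature.Analysis.PDE
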